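import Mathlib
import Summits.CriticalPhenomena.Ising3DConformalLimit.Theses.GaussianScaleMixture
import Summits.CriticalPhenomena.Ising3DConformalLimit.Theorems.GaussianScaleMixtureCriticalTwoPointGSMCriticalTwoPointGSMOfCubeRepNoFace
import Summits.CriticalPhenomena.Ising3DConformalLimit.Theorems.GaussianScaleMixtureCriticalTwoPointGSMCubeRepIffDualCone

/-!
# The closed-cone reduction of the crux `CriticalTwoPointGSM` (line `Sketch`, seat c2)

Crux r2 of route `GaussianScaleMixture` (`Ising3DConformalLimit`), item stmt-CriticalPhenomena-8365:
`⟨σ₀σ_x⟩⁺_{β_c}` on `ℤ³` is a Gaussian scale mixture in the squared coordinates.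

In cube coordinates `tᵢ = e^{-sᵢ}` a CUBE REPRESENTATION of a kernel `G : ℤ³ → ℝ` is a probability
measure on `ℝ³` carried by the closed cube `[0,1]³` with `G x = ∫ ∏ᵢ tᵢ^{xᵢ²} dμ` (`ℕ`-powers,
`0⁰ = 1`) — membership of `G` in the CLOSED Gaussian-scale-mixture cone; mass on the faces
`{tᵢ = 0}` ("clocks of infinite speed") is the only difference between the closed cone and the crux
as typed (`Theorems.criticalTwoPointGSM_iff_cubeRepNoFace`, p98640). This file records, as
importable theorems, the necessary-and-sufficient split that the lead's skeleton
(`Cruxes/CriticalTwoPointGSM/Lines/Sketch.lean`) is built on: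

* `closedConeGSM_of_criticalTwoPointGSM`: the crux implies closed-cone membership of
  `criticalTwoPoint 3` (so a crux re-typed as closed-cone membership is WEAKER than the present one);
* `criticalTwoPointGSM_iff_closedCone_faceAbsorption`: crux ⇔ (closed-cone membership) ∧
  (face absorption), both conjuncts necessary;
* `closedConeGSM_iff_dualCone`: closed-cone membership of `criticalTwoPoint 3` ⇔ every
  square-lacunary dual-cone certificate passes — `∑ cₖ G(xₖ) ≥ 0` whenever
  `∑ cₖ ∏ tᵢ^{x_{k,i}²} ≥ 0` on `[0,1]³` (from `Theorems.cubeRep_iff_dualCone`, p123076, and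
  `criticalTwoPoint_zero'`); this is the falsifiable content of the crux (what the disprover's
  numerics test) and, by `Theorems.limitKernelGSM_of_cubeRep` (p100954), all that the route's
  consumer `LimitKernelGSM` needs;
* `dualCone_of_criticalTwoPointGSM`: the crux passes every such certificate (the importable form of
  the disprover's kill switch `Disproof.dual_cone`).
-/

namespace Summit.CriticalPhenomena.Ising3DConformalLimit.Theorems

open MeasureTheory Filter Topology
open Literature.Probability.LatticeModels
open Summit.CriticalPhenomena.Ising3DConformalLimit.Theses.GaussianScaleMixture (CriticalTwoPointGSM)
open scoped BigOperators

/-- **Necessity of closed-cone membership.** The crux gives a cube representation of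
`criticalTwoPoint 3`: a representation without face mass
(`Theorems.cubeRepNoFace_of_criticalTwoPointGSM`, p98640) is in particular a cube representation,
since `{∃ i, tᵢ < 0 ∨ 1 < tᵢ} ⊆ {∃ i, tᵢ ≤ 0 ∨ 1 < tᵢ}`. -/
theorem closedConeGSM_of_criticalTwoPointGSM (h : CriticalTwoPointGSM) :
    ∃ μ : Measure (Fin 3 → ℝ), IsProbabilityMeasure μ ∧ μ {t | ∃ i, t i < 0 ∨ 1 < t i} = 0 ∧
      ∀ x : Site 3, criticalTwoPoint 3 x = ∫ t, ∏ i, (t i) ^ ((x i).natAbs ^ 2) ∂μ := by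
  obtain ⟨μ, hP, hface, hrep⟩ := cubeRepNoFace_of_criticalTwoPointGSM h
  refine ⟨μ, hP, measure_mono_null (fun t ht => ?_) hface, hrep⟩
  obtain ⟨i, hi⟩ := ht
  exact ⟨i, hi.imp le_of_lt id⟩

/-- **The split is exact.** The crux is equivalent to the conjunction of closed-cone membership of
`criticalTwoPoint 3` and face absorption (a cube representation can be chosen without face mass);
both conjuncts are necessary (`closedConeGSM_of_criticalTwoPointGSM` and p98640) and together they
are sufficient (`Theorems.criticalTwoPointGSM_of_cubeRepNoFace`, p98640). -/
theorem criticalTwoPointGSM_iff_closedCone_faceAbsorption :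
    CriticalTwoPointGSM ↔
      ((∃ μ : Measure (Fin 3 → ℝ), IsProbabilityMeasure μ ∧ μ {t | ∃ i, t i < 0 ∨ 1 < t i} = 0 ∧
          ∀ x : Site 3, criticalTwoPoint 3 x = ∫ t, ∏ i, (t i) ^ ((x i).natAbs ^ 2) ∂μ) ∧
        ((∃ μ : Measure (Fin 3 → ℝ), IsProbabilityMeasure μ ∧ μ {t | ∃ i, t i < 0 ∨ 1 < t i} = 0 ∧
            ∀ x : Site 3, criticalTwoPoint 3 x = ∫ t, ∏ i, (t i) ^ ((x i).natAbs ^ 2) ∂μ) →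
          ∃ μ : Measure (Fin 3 → ℝ), IsProbabilityMeasure μ ∧ μ {t | ∃ i, t i ≤ 0 ∨ 1 < t i} = 0 ∧
            ∀ x : Site 3, criticalTwoPoint 3 x = ∫ t, ∏ i, (t i) ^ ((x i).natAbs ^ 2) ∂μ)) :=
  ⟨fun h => ⟨closedConeGSM_of_criticalTwoPointGSM h, fun _ => cubeRepNoFace_of_criticalTwoPointGSM h⟩,
    fun h => criticalTwoPointGSM_of_cubeRepNoFace (h.2 h.1)⟩

/-- **Closed-cone membership in certificate form.** `criticalTwoPoint 3` has a cube representation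
iff it passes every dual-cone inequality: `∑ cₖ G(xₖ) ≥ 0` whenever the square-lacunary polynomial
`∑ cₖ ∏ tᵢ^{x_{k,i}²}` is non-negative on `[0,1]³` (`Theorems.cubeRep_iff_dualCone`, p123076; the
normalisation `G 0 = 1` is `criticalTwoPoint_zero'`). -/
theorem closedConeGSM_iff_dualCone :
    (∃ μ : Measure (Fin 3 → ℝ), IsProbabilityMeasure μ ∧ μ {t | ∃ i, t i < 0 ∨ 1 < t i} = 0 ∧
        ∀ x : Site 3, criticalTwoPoint 3 x = ∫ t, ∏ i, (t i) ^ ((x i).natAbs ^ 2) ∂μ) ↔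
      ∀ (m : ℕ) (c : Fin m → ℝ) (x : Fin m → Site 3),
        (∀ t : Fin 3 → ℝ, (∀ i, 0 ≤ t i ∧ t i ≤ 1) →
          0 ≤ ∑ k, c k * ∏ i, (t i) ^ ((x k i).natAbs ^ 2)) →
        0 ≤ ∑ k, c k * criticalTwoPoint 3 (x k) := by
  rw [cubeRep_iff_dualCone (criticalTwoPoint 3)]
  exact ⟨fun h => h.2, fun h => ⟨criticalTwoPoint_zero' (d := 3), h⟩⟩

/-- **The crux passes every square-lacunary certificate** (importable form of the disprover's kill
switch `Disproof.dual_cone`): if `∑ cₖ ∏ tᵢ^{x_{k,i}²} ≥ 0` on `[0,1]³` then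
`∑ cₖ ⟨σ₀σ_{xₖ}⟩⁺_{β_c} ≥ 0`. -/
theorem dualCone_of_criticalTwoPointGSM (h : CriticalTwoPointGSM) {m : ℕ} (c : Fin m → ℝ)
    (x : Fin m → Site 3)
    (hc : ∀ t : Fin 3 → ℝ, (∀ i, 0 ≤ t i ∧ t i ≤ 1) →
      0 ≤ ∑ k, c k * ∏ i, (t i) ^ ((x k i).natAbs ^ 2)) :
    0 ≤ ∑ k, c k * criticalTwoPoint 3 (x k) :=
  closedConeGSM_iff_dualCone.1 (closedConeGSM_of_criticalTwoPointGSM h) m c x hc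

end Summit.CriticalPhenomena.Ising3DConformalLimit.Theorems
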